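import Summits.RiemannHypothesis.RiemannHypothesis.Theorems.PfPersistenceEntryTubes
import Summits.RiemannHypothesis.RiemannHypothesis.Theorems.PfPersistenceCouplingTubeStrict
import HarnessLib

/-!
# Existence of G1 separators on NEGATIVELY SATURATED domains ≡ strict / height-floored positivity of `ζ` (typer gen 9)

**HONEST FRAMING. This is a long-odds MECHANISM SEARCH; no RH claims.** RH-free typing, continuing
`PfPersistenceEntryTubes` (tube reduction: a window-wise open / G1-cont separator exists iff an ENTRY TUBE about the
centre separates) and cand-6's `PfPersistenceCouplingTubeStrict` (the height-floored coupling tube is G1-contU).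

The barrier's EXISTENCE question "is there an `S` in class `X` with `ζ ∈ S` and `S ∩ DN(D) = ∅`?" is answered here for
the OTHER extreme of the domain parameter: domains `D` that are NEGATIVELY SATURATED (`NegSaturated D`: every
detectably-negative datum belongs to `D` — the full operator domain `Set.univ`, or any `D ⊇ {d | DetectablyNegative d}`).
All `↔` below are PROVED and RH-free; their right-hand sides are OPEN properties of `ζ`'s window tables.

* §1 on a saturated domain every member of a separating criterion is all-window positive
  (`Separates.allWindowsPositive_of_mem`);
* §2 WINDOW-WISE OPEN / G1-cont EXISTENCE `≡ ζ ∈ P⁺` (strict positivity at every window):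
  `exists_windowwiseOpen_separates_iff_strict`, `exists_inG1cont_separates_iff_strict` — `→`: a tube about a centre
  with a non-trivial isotropic vector contains the down-shift `d₀ − (r/2)·1`, which is detectably negative; `←`:
  `P⁺` itself (`inG1cont_strictPositiveClass`);
* §3 the G1-int row: a G1-int criterion containing `ζ` contains an entry tube about `ζ` (window-wise local constancy
  at `ζ` forces the per-window neighbourhoods into the factors), so G1-int EXISTENCE `≡ BoxIsolated D ζ` on every
  domain (`exists_inG1int_separates_iff`) and `≡ ζ ∈ P⁺` on saturated ones;
* §4 G1-contU EXISTENCE `≡ HeightFlooredPositive ζ` (a positive Loewner floor `m_A·1 ≤ ζ_w` on every bounded height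
  range `a_w ≤ A`, uniformly in `N`): `→` reads the SHIFT ESCAPE clause (the member agreeing with `ζ − δ·1` below
  height `A` is all-window positive), `←` is cand-6's coupling tube with slack half the floor
  (`exists_inG1contU_separates_iff_heightFloored`).
Together with the dial-domain column (`PfPersistenceThinTubeTrace` / `PfPersistenceFlooredTubes`: every row `≡
AllWindowsPositive ζ`) this is the typed EXISTENCE TABLE of the barrier: existence of an invariant in any typed class is
EXACTLY a positivity property of `ζ` (`AllWindowsPositive ⇐ P⁺ ⇐ HeightFlooredPositive`), never less. No RH claims.
-/

set_option linter.dupNamespace false  -- the mandated namespace repeats `RiemannHypothesis`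

open Real Finset Matrix Filter Topology

namespace Summit.RiemannHypothesis.RiemannHypothesis.Theorems.PfPersistence

/-! ## §1 Negatively saturated domains -/

/-- NEGATIVELY SATURATED domain: it contains every detectably-negative datum (e.g. `Set.univ`). [folklore] -/
def NegSaturated (D : Set Datum) : Prop := ∀ d : Datum, DetectablyNegative d → d ∈ D

/-- PROVED: the full operator domain is saturated. [folklore] -/
theorem negSaturated_univ : NegSaturated (Set.univ : Set Datum) := fun _ _ => Set.mem_univ _

/-- PROVED: saturation passes to super-domains. [folklore] -/
theorem NegSaturated.mono {D D' : Set Datum} (h : NegSaturated D) (hDD' : D ⊆ D') : NegSaturated D' :=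
  fun d hd => hDD' (h d hd)

/-- PROVED: on a saturated domain every MEMBER of a separating criterion is all-window positive. [folklore] -/
theorem Separates.allWindowsPositive_of_mem {S D : Set Datum} {d₀ : Datum} (h : Separates S D d₀)
    (hD : NegSaturated D) {d : Datum} (hd : d ∈ S) : AllWindowsPositive d := by
  by_contra hneg
  have hdn := (detectablyNegative_iff_not_allWindowsPositive d).2 hneg
  exact h.2 d (hD d hdn) hdn hd

/-- PROVED: so a separating criterion on a saturated domain is a sub-class of `𝒫`. [folklore] -/
theorem Separates.subset_positiveClass {S D : Set Datum} {d₀ : Datum} (h : Separates S D d₀) (hD : NegSaturated D) :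
    S ⊆ positiveClass := fun _ hd => h.allWindowsPositive_of_mem hD hd

/-! ## §2 Window-wise open / G1-cont existence on saturated domains ≡ strict positivity of the centre -/

/-- PROVED: `0 < vᵀv` for `v ≠ 0` (local copy; the tree's `dotProduct_self_pos_of_ne_zero` lives in an
unrelated branch of the import graph). [folklore] -/
private theorem dotSelf_pos {k : ℕ} {v : Fin k → ℝ} (hv : v ≠ 0) : 0 < v ⬝ᵥ v :=
  lt_of_le_of_ne (dotProduct_self_nonneg_real v) fun h => hv (dotProduct_self_eq_zero.1 h.symm)

/-- PROVED: the down-shift `d₀ − (r/2)·1` lies in the entry tube of profile `r` about `d₀`. [folklore] -/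
theorem downShift_mem_entryTube {r : Window → ℝ} (hr : ∀ win, 0 < r win) (d₀ : Datum) :
    (fun w : Window => d₀ w - (r w / 2) • (1 : Matrix (Fin (w.N + 1)) (Fin (w.N + 1)) ℝ)) ∈ entryTube r d₀ := by
  intro win i j
  simp only [Matrix.sub_apply, Matrix.smul_apply, Matrix.one_apply, smul_eq_mul, sub_sub_cancel_left, abs_neg]
  have := hr win
  split_ifs
  · rw [mul_one, abs_of_pos (by linarith)]; linarith
  · simpa using this

/-- PROVED: the down-shift lowers every window form by `(r/2)·vᵀv`. [folklore] -/
theorem downShift_form (r : Window → ℝ) (d₀ : Datum) (win : Window) (v : Fin (win.N + 1) → ℝ) :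
    v ⬝ᵥ ((d₀ win - (r win / 2) • (1 : Matrix (Fin (win.N + 1)) (Fin (win.N + 1)) ℝ)) *ᵥ v)
      = v ⬝ᵥ (d₀ win *ᵥ v) - r win / 2 * (v ⬝ᵥ v) := by
  rw [Matrix.sub_mulVec, dotProduct_sub, Matrix.smul_mulVec, Matrix.one_mulVec, dotProduct_smul, smul_eq_mul]

/-- **PROVED — A TUBE SEPARATOR ON A SATURATED DOMAIN FORCES STRICT POSITIVITY OF THE CENTRE:** otherwise some
window has an isotropic `v ≠ 0` and the down-shift is a detectably-negative tube member. [folklore] -/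
theorem mem_strictPositiveClass_of_boxIsolated {D : Set Datum} {d₀ : Datum} (hD : NegSaturated D)
    (h : BoxIsolated D d₀) : d₀ ∈ strictPositiveClass := by
  obtain ⟨r, hr, hsep⟩ := h
  intro win v hv
  by_contra hle
  rw [not_lt] at hle
  have hvv := dotSelf_pos hv
  have hneg : DetectablyNegative
      (fun w : Window => d₀ w - (r w / 2) • (1 : Matrix (Fin (w.N + 1)) (Fin (w.N + 1)) ℝ)) :=
    ⟨win, v, by rw [downShift_form]; nlinarith [hr win]⟩
  exact hsep.2 _ (hD _ hneg) hneg (downShift_mem_entryTube hr d₀)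

/-- PROVED: on a saturated domain, tube isolation of `d₀` `≡ d₀ ∈ P⁺`. [folklore] -/
theorem boxIsolated_iff_strict {D : Set Datum} (hD : NegSaturated D) (d₀ : Datum) :
    BoxIsolated D d₀ ↔ d₀ ∈ strictPositiveClass :=
  ⟨mem_strictPositiveClass_of_boxIsolated hD, fun h => boxIsolated_of_mem_strictPositiveClass h D⟩

/-- **PROVED — WINDOW-WISE OPEN EXISTENCE on saturated domains `≡` STRICT POSITIVITY of the centre.** [folklore] -/
theorem exists_windowwiseOpen_separates_iff_strict {D : Set Datum} (hD : NegSaturated D) (d₀ : Datum) :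
    (∃ S, IsWindowwiseOpen S ∧ Separates S D d₀) ↔ d₀ ∈ strictPositiveClass :=
  (exists_windowwiseOpen_separates_iff D d₀).trans (boxIsolated_iff_strict hD d₀)

/-- **PROVED — G1-cont EXISTENCE on saturated domains `≡` STRICT POSITIVITY of the centre.** [folklore] -/
theorem exists_inG1cont_separates_iff_strict {D : Set Datum} (hD : NegSaturated D) (d₀ : Datum) :
    (∃ S, InG1cont S ∧ Separates S D d₀) ↔ d₀ ∈ strictPositiveClass :=
  (exists_inG1cont_separates_iff D d₀).trans (boxIsolated_iff_strict hD d₀)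

/-- PROVED: the full-domain instance for `ζ`. [folklore] -/
theorem exists_inG1cont_separates_univ_iff :
    (∃ S, InG1cont S ∧ Separates S Set.univ zetaDatum) ↔ zetaDatum ∈ strictPositiveClass :=
  exists_inG1cont_separates_iff_strict negSaturated_univ zetaDatum

/-! ## §3 The G1-int row -/

/-- PROVED: entry tubes are window-wise (product) criteria. [folklore] -/
theorem isWindowwise_entryTube (r : Window → ℝ) (d₀ : Datum) : IsWindowwise (entryTube r d₀) :=
  ⟨fun win => {M | ∀ i j, |M i j - d₀ win i j| < r win}, rfl⟩

/-- **PROVED — G1-int MEMBERSHIP of every positive-profile entry tube about `ζ`.** [folklore] -/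
theorem inG1int_entryTube {r : Window → ℝ} (hr : ∀ win, 0 < r win) : InG1int (entryTube r zetaDatum) :=
  ⟨isWindowwise_entryTube r _, (isWindowwiseOpen_entryTube r _).locallyConstantAt (mem_entryTube_self hr _),
    nonlocalAtEveryHeight_entryTube hr _, (isWindowwiseOpen_entryTube r _).dialStable⟩

/-- **PROVED — BOX BASIS FOR G1-int:** a G1-int criterion containing `ζ` contains an entry tube about `ζ` (local
constancy at `ζ` puts each per-window neighbourhood inside the corresponding factor). [folklore] -/
theorem InG1int.exists_entryTube_subset {S : Set Datum} (hS : InG1int S) (hζ : zetaDatum ∈ S) :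
    ∃ r : Window → ℝ, (∀ win, 0 < r win) ∧ entryTube r zetaDatum ⊆ S := by
  classical
  obtain ⟨⟨V, rfl⟩, hlc, -, -⟩ := hS
  have hζV : ∀ win, zetaDatum win ∈ V win := hζ
  have key : ∀ win : Window, ∃ ε : ℝ, 0 < ε ∧ ∀ M : Matrix (Fin (win.N + 1)) (Fin (win.N + 1)) ℝ,
      (∀ i j, |M i j - zetaDatum win i j| < ε) → M ∈ V win := by
    intro win
    obtain ⟨O, hO, hζO, hconst⟩ := hlc win
    have hOV : O ⊆ V win := by
      intro M hM
      have hiff := hconst zetaDatum (Function.update zetaDatum win M) (fun w hw => by simp [hw]) hζO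
        (by simpa using hM)
      have hmem : ∀ w, Function.update zetaDatum win M w ∈ V w := hiff.1 hζV
      simpa using hmem win
    have hOo : IsOpen (show Set (Fin (win.N + 1) → Fin (win.N + 1) → ℝ) from O) := hO
    obtain ⟨ε, hε, hball⟩ := Metric.isOpen_iff.1 hOo (zetaDatum win) hζO
    refine ⟨ε, hε, fun M hM => hOV (hball ?_)⟩
    rw [Metric.mem_ball, dist_pi_lt_iff hε]
    intro i
    rw [dist_pi_lt_iff hε]
    intro j
    rw [Real.dist_eq]
    exact hM i j
  choose r hr hrV using key
  exact ⟨r, hr, fun d hd win => hrV win (d win) (hd win)⟩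

/-- **PROVED — THE TUBE REDUCTION (G1-int):** a G1-int separator for `ζ` exists iff a tube separator exists (every
domain). [folklore] -/
theorem exists_inG1int_separates_iff (D : Set Datum) :
    (∃ S, InG1int S ∧ Separates S D zetaDatum) ↔ BoxIsolated D zetaDatum :=
  ⟨fun ⟨_, hS, hsep⟩ =>
      let ⟨r, hr, hsub⟩ := hS.exists_entryTube_subset hsep.1
      ⟨r, hr, hsep.of_subset hsub (mem_entryTube_self hr _)⟩,
    fun ⟨_, hr, hsep⟩ => ⟨_, inG1int_entryTube hr, hsep⟩⟩

/-- **PROVED — G1-int EXISTENCE on saturated domains `≡ ζ ∈ P⁺`.** [folklore] -/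
theorem exists_inG1int_separates_iff_strict {D : Set Datum} (hD : NegSaturated D) :
    (∃ S, InG1int S ∧ Separates S D zetaDatum) ↔ zetaDatum ∈ strictPositiveClass :=
  (exists_inG1int_separates_iff D).trans (boxIsolated_iff_strict hD zetaDatum)

/-! ## §4 G1-contU existence on saturated domains ≡ height-floored positivity of `ζ` -/

/-- HEIGHT-FLOORED POSITIVITY of a datum: on every bounded height range `a_w ≤ A` a positive Loewner floor
`m_A · vᵀv ≤ vᵀ d_w v`, uniformly in the resolution `N`. Implies strict positivity. [folklore] -/
def HeightFlooredPositive (d : Datum) : Prop :=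
  ∀ A : ℝ, ∃ m : ℝ, 0 < m ∧ ∀ win : Window, win.a ≤ A → ∀ v : Fin (win.N + 1) → ℝ, m * (v ⬝ᵥ v) ≤ v ⬝ᵥ (d win *ᵥ v)

/-- PROVED: floored ⇒ strictly positive at every window. [folklore] -/
theorem HeightFlooredPositive.mem_strictPositiveClass {d : Datum} (h : HeightFlooredPositive d) :
    d ∈ strictPositiveClass := by
  intro win v hv
  obtain ⟨m, hm, hfl⟩ := h win.a
  exact lt_of_lt_of_le (mul_pos hm (dotSelf_pos hv)) (hfl win le_rfl v)

/-- PROVED: floored ⇒ all-window positive. [folklore] -/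
theorem HeightFlooredPositive.allWindowsPositive {d : Datum} (h : HeightFlooredPositive d) : AllWindowsPositive d :=
  strictPositiveClass_subset_positiveClass h.mem_strictPositiveClass

/-- **PROVED — THE SHIFT-ESCAPE CLAUSE READS A FLOOR:** a G1-contU separator for `ζ` on a saturated domain forces
height-floored positivity of `ζ` — the member agreeing with `ζ − δ·1` below height `A` (some `δ > 0`) is all-window
positive. [folklore] -/
theorem heightFloored_of_exists_inG1contU_separates {D : Set Datum} (hD : NegSaturated D)
    (h : ∃ S, InG1contU S ∧ Separates S D zetaDatum) : HeightFlooredPositive zetaDatum := by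
  obtain ⟨S, ⟨-, hesc⟩, hsep⟩ := h
  intro A
  have hshift := (hesc hsep.1).2 A
  have hle : 𝓝[Set.Ioi (0 : ℝ)] (0 : ℝ) ≤ 𝓝[≠] (0 : ℝ) :=
    nhdsWithin_mono 0 fun x hx => Set.mem_compl_singleton_iff.2 (Set.mem_Ioi.1 hx).ne'
  have hpos : ∀ᶠ δ : ℝ in 𝓝[Set.Ioi (0 : ℝ)] (0 : ℝ), δ ∈ Set.Ioi (0 : ℝ) := eventually_mem_nhdsWithin
  obtain ⟨δ, hδ, d, hdS, hd⟩ := (hpos.and (hshift.filter_mono hle)).exists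
  refine ⟨δ, Set.mem_Ioi.1 hδ, fun win hwin v => ?_⟩
  have hawp := hsep.allWindowsPositive_of_mem hD hdS win v
  rw [← hd win hwin] at hawp
  change 0 ≤ v ⬝ᵥ ((zetaDatum win - δ • (1 : Matrix (Fin (win.N + 1)) (Fin (win.N + 1)) ℝ)) *ᵥ v) at hawp
  rw [Matrix.sub_mulVec, dotProduct_sub, Matrix.smul_mulVec, Matrix.one_mulVec, dotProduct_smul, smul_eq_mul] at hawp
  linarith

/-- PROVED: a floor on every bounded height range yields a positive SLACK PROFILE, floored on bounded heights, with
`2 s_w · 1 ≤ d_w` (choose the floor at the integer height `⌈a_w⌉`). [folklore] -/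
theorem exists_slack_of_heightFloored {d : Datum} (h : HeightFlooredPositive d) :
    ∃ s : Window → ℝ, (∀ win, 0 < s win) ∧ (∀ A : ℝ, ∃ m : ℝ, 0 < m ∧ ∀ win : Window, win.a ≤ A → m ≤ s win) ∧
      ∀ (win : Window) (v : Fin (win.N + 1) → ℝ), 2 * s win * (v ⬝ᵥ v) ≤ v ⬝ᵥ (d win *ᵥ v) := by
  choose m hm hfl using fun n : ℕ => h n
  refine ⟨fun win => m ⌈win.a⌉₊ / 2, fun win => by have := hm ⌈win.a⌉₊; positivity, fun A => ?_, fun win v => ?_⟩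
  · obtain ⟨k₀, -, hmin⟩ := (Finset.range (⌈A⌉₊ + 1)).exists_min_image m ⟨0, by simp⟩
    refine ⟨m k₀ / 2, by have := hm k₀; positivity, fun win hwin => ?_⟩
    have hmem : ⌈win.a⌉₊ ∈ Finset.range (⌈A⌉₊ + 1) :=
      Finset.mem_range.2 (Nat.lt_succ_of_le (Nat.ceil_mono hwin))
    have := hmin _ hmem
    simp only
    linarith
  · have := hfl ⌈win.a⌉₊ win (Nat.le_ceil _) v
    simp only
    linarith

/-- PROVED: with slack at most half a floor, cand-6's coupling tube is a sub-class of `P⁺`. [folklore] -/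
theorem tube_subset_strictPositiveClass {s : Window → ℝ} (hs : ∀ win, 0 < s win)
    (hsd : ∀ (win : Window) (v : Fin (win.N + 1) → ℝ), 2 * s win * (v ⬝ᵥ v) ≤ v ⬝ᵥ (zetaDatum win *ᵥ v)) :
    {d : Datum | ∀ win : Window, WindowStrictlyPositive
      (d win - zetaDatum win + s win • (1 : Matrix (Fin (win.N + 1)) (Fin (win.N + 1)) ℝ))} ⊆
      strictPositiveClass := by
  intro d hd win v hv
  have h1 := hd win v hv
  rw [Matrix.add_mulVec, Matrix.sub_mulVec, dotProduct_add, dotProduct_sub, Matrix.smul_mulVec, Matrix.one_mulVec,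
    dotProduct_smul, smul_eq_mul] at h1
  have h2 := hsd win v
  have hvv : 0 ≤ v ⬝ᵥ v := dotProduct_self_nonneg_real v
  nlinarith [hs win]

/-- PROVED: such a tube SEPARATES `ζ` from the negatives of EVERY domain. [folklore] -/
theorem separates_tube_of_floor {s : Window → ℝ} (hs : ∀ win, 0 < s win)
    (hsd : ∀ (win : Window) (v : Fin (win.N + 1) → ℝ), 2 * s win * (v ⬝ᵥ v) ≤ v ⬝ᵥ (zetaDatum win *ᵥ v))
    (D : Set Datum) :
    Separates {d : Datum | ∀ win : Window, WindowStrictlyPositive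
      (d win - zetaDatum win + s win • (1 : Matrix (Fin (win.N + 1)) (Fin (win.N + 1)) ℝ))} D zetaDatum :=
  ⟨zeta_mem_tube hs, fun d _ hneg hd => (detectablyNegative_iff_not_allWindowsPositive d).1 hneg
    (strictPositiveClass_subset_positiveClass (tube_subset_strictPositiveClass hs hsd hd))⟩

/-- **PROVED — FLOORS GIVE A G1-contU SEPARATOR ON EVERY DOMAIN** (cand-6's tube, slack = half the floor). [folklore] -/
theorem exists_inG1contU_separates_of_heightFloored (h : HeightFlooredPositive zetaDatum) (D : Set Datum) :
    ∃ S, InG1contU S ∧ Separates S D zetaDatum := by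
  obtain ⟨s, hs, hsA, hsd⟩ := exists_slack_of_heightFloored h
  exact ⟨_, inG1contU_tube hs hsA, separates_tube_of_floor hs hsd D⟩

/-- **PROVED — HEADLINE (G1-contU EXISTENCE on saturated domains `≡` HEIGHT-FLOORED POSITIVITY OF `ζ`).** For every
negatively saturated `D` (in particular `Set.univ`): a G1-contU criterion separating `ζ` from the negatives of `D`
EXISTS iff `ζ`'s window tables have a positive Loewner floor on every bounded height range. RH-free; both sides OPEN
(the right side is at least strict all-window positivity). [folklore] -/
theorem exists_inG1contU_separates_iff_heightFloored {D : Set Datum} (hD : NegSaturated D) :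
    (∃ S, InG1contU S ∧ Separates S D zetaDatum) ↔ HeightFlooredPositive zetaDatum :=
  ⟨heightFloored_of_exists_inG1contU_separates hD, fun h => exists_inG1contU_separates_of_heightFloored h D⟩

/-- PROVED: the full-domain instance. [folklore] -/
theorem exists_inG1contU_separates_univ_iff :
    (∃ S, InG1contU S ∧ Separates S Set.univ zetaDatum) ↔ HeightFlooredPositive zetaDatum :=
  exists_inG1contU_separates_iff_heightFloored negSaturated_univ

/-! ## §5 The chain for an arbitrary domain -/

/-- **PROVED — THE EXISTENCE CHAIN ON ANY DOMAIN `D ∋ ζ`:** `HeightFlooredPositive ζ ⇒ (∃ G1-contU separator) ⇒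
(∃ G1-cont separator) ⇒ (∃ window-wise open separator) ⇒ AllWindowsPositive ζ`; the first arrow reverses on
saturated domains (§4), the last three collapse to `↔ AllWindowsPositive ζ` on dial domains
(`PfPersistenceThinTubeTrace`). [folklore] -/
theorem existence_chain (D : Set Datum) (hζ : zetaDatum ∈ D) :
    (HeightFlooredPositive zetaDatum → ∃ S, InG1contU S ∧ Separates S D zetaDatum) ∧
    ((∃ S, InG1contU S ∧ Separates S D zetaDatum) → ∃ S, InG1cont S ∧ Separates S D zetaDatum) ∧
    ((∃ S, InG1cont S ∧ Separates S D zetaDatum) → ∃ S, IsWindowwiseOpen S ∧ Separates S D zetaDatum) ∧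
    ((∃ S, IsWindowwiseOpen S ∧ Separates S D zetaDatum) → AllWindowsPositive zetaDatum) :=
  ⟨fun h => exists_inG1contU_separates_of_heightFloored h D, fun ⟨S, hS, hsep⟩ => ⟨S, hS.1, hsep⟩,
    fun ⟨S, hS, hsep⟩ => ⟨S, hS.1, hsep⟩, fun ⟨_, _, hsep⟩ => hsep.allWindowsPositive hζ⟩

end Summit.RiemannHypothesis.RiemannHypothesis.Theorems.PfPersistence
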